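import Summits.CriticalPhenomena.PercolationContinuityZ3.Theorems.Transplant.SkelPhiWinChainF
import HarnessLib

/-!
# N1 (the `{±1}` node), (R) column (N1-R-PLAN v2 §4 (R3); rulings NEG-SCOPE B.12/B.13): THE BRIDGE FRAME — the ONE exceptional step of the
# root run between the root's own long link and the long run, as a route-free schedule frame `ChainPlanar.SchedFrame` of ONE step in PLAIN
# (oriented, root-relative) planar coordinates: core `0` = the hop's landing box `[B₀lo, B₀hi]`, kit centres in its `R′`-enlargement, region =
# enlargement `+` the bridge prism's bounding box `±pr`, core `1` = enlargement `+` the landing displacement box `[dlo, dhi] ⊆ [−pr, pr]²` — pure `Site 2`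

WHY A FRAME AND NOT A RUN (memo HOME/prim-bschramm-p3-g9/N1-R-PLAN-v2.md §2, B.13): the bridge is a single stride at the third Step-I″ scale `(M_b, n_b)` whose family / signs
are FIXED by the orientation case (same orientation: x_b side half, along advance `n_b`; transposed: x_b with `σ = sign h_b, τ = +1` (advance `∈ [|h_b|, |h_b|+ℓ_b]`) or the
y′_b top piece (advance `≥ ℓ_b − |h_b| − 12`)), so no steering is needed and every case is "seed centre `c` in the enlarged core ⟹ prism `⊆ c ± pr ⊆ region`, landing
`⊆ c + [dlo, dhi] ⊆ core 1`".  The along-CLEARANCES that keep every prism off the pinned seed ball are the two one-line facts `regionLo_apply` / `core1lo_apply`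
(`region ≥ B₀lo − R′ − pr`, `core 1 ≥ B₀lo − R′ + dlo` coordinatewise): with `B₀lo ∥ = n_L`, (R-F1) `n_L − R′ − pr > k` and (R-F2) `dlo ∥ ≥ Δ₀ := k + 2R′ + 1` (R′ ≥ Rlev + 1
is the ledger's siting radius) they put the bridge region and every later long prism beyond the ball `{|α − α_t| ≤ k}`.
builds on p205010 (kernel theorem, internal audit signed; external expert review pending) — nothing in this file uses p205010; nothing here is a claim about the open node.
Lane `prim-bschramm`, seat `prim-bschramm-p3` (gen 9; design owner + (R) owner); helper file (`--supports stmt-CriticalPhenomena-4575 --as helper`).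
* §1 `BridgePrm`, `BridgeOK`; §2 `core1Lo/core1Hi/regionLo/regionHi`, **`bridgeFrame`** (`N = 0`), its unfolding lemmas;
* §3 the two route facts `box_subset_region_of_mem_enl` (prism box of a kit centre inside the region) and `disp_subset_core1_of_mem_enl` (landing box inside core 1), and the
  clearance readings `regionLo_apply`, `core1Lo_apply`.
[cite: KozmaNitzan2024, §4 Lemma 11 (pp. 22–23: the target boxes of a straight run), p. 28 ((32) at the root)] [cite: MartineauTassion2017, §3.2 (the pieces of Lemma 3.5)]
-/

noncomputable section

namespace Summit.CriticalPhenomena.PercolationContinuityZ3.Theorems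

namespace Transplant

namespace ChainPlanar

open Literature.Probability.Percolation Literature.Probability.LatticeModels

/-! ## §1 Parameters -/

/-- **Parameters of the bridge step** (plain planar coordinates relative to the root). [this work] -/
structure BridgePrm where
  /-- lower corner of the hop's landing box (core `0`) -/
  B₀lo : Site 2
  /-- upper corner of the hop's landing box -/
  B₀hi : Site 2
  /-- siting radius (kit centre vs arrival box; `≥ Rlev + 1`) -/
  R' : ℕ
  /-- lower corner of the landing displacement box of the bridge stride (relative to the seed centre) -/
  dlo : Site 2
  /-- upper corner of the landing displacement box -/
  dhi : Site 2
  /-- sup-norm bound of the bridge stride's prism about its seed centre -/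
  pr : ℕ

/-- **Admissible bridge parameters**: the two boxes are boxes and the displacement box lies in the prism box. [this work] -/
structure BridgeOK (B : BridgePrm) : Prop where
  h0 : B.B₀lo ≤ B.B₀hi
  hd : B.dlo ≤ B.dhi
  hdpr : ∀ i, -(B.pr : ℤ) ≤ B.dlo i ∧ B.dhi i ≤ B.pr

namespace BridgePrm

variable (B : BridgePrm)

/-! ## §2 The frame -/

/-- Lower corner of core `1`: `B₀lo − R′ + dlo`. [this work] -/
def core1Lo : Site 2 := B.B₀lo - ((B.R' : ℕ) : Site 2) + B.dlo

/-- Upper corner of core `1`: `B₀hi + R′ + dhi`. [this work] -/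
def core1Hi : Site 2 := B.B₀hi + ((B.R' : ℕ) : Site 2) + B.dhi

/-- Lower corner of the region: `B₀lo − R′ − pr`. [this work] -/
def regionLo : Site 2 := B.B₀lo - ((B.R' : ℕ) : Site 2) - ((B.pr : ℕ) : Site 2)

/-- Upper corner of the region: `B₀hi + R′ + pr`. [this work] -/
def regionHi : Site 2 := B.B₀hi + ((B.R' : ℕ) : Site 2) + ((B.pr : ℕ) : Site 2)

/-- Lower corners of the two cores. [this work] -/
def lo (k : ℕ) : Site 2 := if k = 0 then B.B₀lo else B.core1Lo

/-- Upper corners of the two cores. [this work] -/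
def hi (k : ℕ) : Site 2 := if k = 0 then B.B₀hi else B.core1Hi

/-- Core `0`'s lower corner. [folklore] -/
@[simp] theorem lo_zero : B.lo 0 = B.B₀lo := rfl
/-- Core `0`'s upper corner. [folklore] -/
@[simp] theorem hi_zero : B.hi 0 = B.B₀hi := rfl
/-- Core `1`'s lower corner. [folklore] -/
@[simp] theorem lo_one : B.lo 1 = B.core1Lo := rfl
/-- Core `1`'s upper corner. [folklore] -/
@[simp] theorem hi_one : B.hi 1 = B.core1Hi := rfl
/-- Core `1`'s lower corner, coordinatewise. [folklore] -/
@[simp] theorem core1Lo_apply (i : Fin 2) : B.core1Lo i = B.B₀lo i - B.R' + B.dlo i := by simp [core1Lo]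
/-- Core `1`'s upper corner, coordinatewise. [folklore] -/
@[simp] theorem core1Hi_apply (i : Fin 2) : B.core1Hi i = B.B₀hi i + B.R' + B.dhi i := by simp [core1Hi]
/-- The region's lower corner, coordinatewise. [folklore] -/
@[simp] theorem regionLo_apply (i : Fin 2) : B.regionLo i = B.B₀lo i - B.R' - B.pr := by simp [regionLo]
/-- The region's upper corner, coordinatewise. [folklore] -/
@[simp] theorem regionHi_apply (i : Fin 2) : B.regionHi i = B.B₀hi i + B.R' + B.pr := by simp [regionHi]

variable {B}

/-- The region holds the `R′`-enlarged core `0`. [folklore] -/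
theorem enl_subset_region : Finset.Icc (B.B₀lo - ((B.R' : ℕ) : Site 2)) (B.B₀hi + ((B.R' : ℕ) : Site 2)) ⊆ Finset.Icc B.regionLo B.regionHi := by
  refine Finset.Icc_subset_Icc (fun i => ?_) (fun i => ?_) <;>
    simp only [Pi.sub_apply, Pi.add_apply, Pi.natCast_apply, regionLo_apply, regionHi_apply] <;> omega

/-- Core `1` is a box. [folklore] -/
theorem core1Lo_le_core1Hi (hB : BridgeOK B) : B.core1Lo ≤ B.core1Hi := by
  intro i
  have h1 : B.B₀lo i ≤ B.B₀hi i := hB.h0 i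
  have h2 : B.dlo i ≤ B.dhi i := hB.hd i
  have h3 : (0 : ℤ) ≤ (B.R' : ℤ) := Int.natCast_nonneg _
  show B.B₀lo i - ((B.R' : ℕ) : Site 2) i + B.dlo i ≤ B.B₀hi i + ((B.R' : ℕ) : Site 2) i + B.dhi i
  simp only [Pi.natCast_apply]
  linarith

/-- The region holds core `1` (`[dlo, dhi] ⊆ [−pr, pr]²`). [folklore] -/
theorem core1_subset_region (hB : BridgeOK B) : Finset.Icc B.core1Lo B.core1Hi ⊆ Finset.Icc B.regionLo B.regionHi := by
  refine Finset.Icc_subset_Icc (fun i => ?_) (fun i => ?_) <;> have := hB.hdpr i <;>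
    simp only [core1Lo_apply, core1Hi_apply, regionLo_apply, regionHi_apply] <;> omega

variable (B)

/-- **THE BRIDGE FRAME**: one step (`N = 0`), axis nominally `0`, cores `0` (the hop's landing box) and `1`, one region = prism. [this work] -/
def bridgeFrame (hB : BridgeOK B) : SchedFrame where
  ax := fun _ => 0
  lo := B.lo
  hi := B.hi
  region := fun _ => Finset.Icc B.regionLo B.regionHi
  prism := Finset.Icc B.regionLo B.regionHi
  N := 0
  R' := B.R'
  encl k hk := by
    obtain rfl : k = 0 := Nat.le_zero.1 hk
    exact enl_subset_region
  succ k hk := by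
    obtain rfl : k = 0 := Nat.le_zero.1 hk
    exact core1_subset_region hB
  sub_prism _ _ := subset_rfl
  nonempty k hk := by
    rcases Nat.le_one_iff_eq_zero_or_eq_one.1 hk with rfl | rfl
    · exact ⟨B.B₀lo, Finset.mem_Icc.2 ⟨le_rfl, hB.h0⟩⟩
    · exact ⟨B.core1Lo, Finset.mem_Icc.2 ⟨le_rfl, core1Lo_le_core1Hi hB⟩⟩

/-! ### Unfolding -/

/-- The bridge frame has one step. [folklore] -/
@[simp] theorem bridgeFrame_N (hB : BridgeOK B) : (B.bridgeFrame hB).N = 0 := rfl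
/-- The bridge frame's radius. [folklore] -/
@[simp] theorem bridgeFrame_R' (hB : BridgeOK B) : (B.bridgeFrame hB).R' = B.R' := rfl
/-- The bridge frame's region. [folklore] -/
@[simp] theorem bridgeFrame_region (hB : BridgeOK B) (k : ℕ) : (B.bridgeFrame hB).region k = Finset.Icc B.regionLo B.regionHi := rfl
/-- The bridge frame's core `0`. [folklore] -/
@[simp] theorem bridgeFrame_core_zero (hB : BridgeOK B) : (B.bridgeFrame hB).core 0 = Finset.Icc B.B₀lo B.B₀hi := rfl
/-- The bridge frame's core `1`. [folklore] -/
@[simp] theorem bridgeFrame_core_one (hB : BridgeOK B) : (B.bridgeFrame hB).core 1 = Finset.Icc B.core1Lo B.core1Hi := rfl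

/-! ## §3 The two route facts and the clearance readings -/

variable {B}

/-- **Route fact 1**: the prism box `c ± pr` of a kit centre `c` of the enlarged core `0` lies in the region. [this work] -/
theorem box_subset_region_of_mem_enl {c : Site 2} (hc : c ∈ Finset.Icc (B.B₀lo - ((B.R' : ℕ) : Site 2)) (B.B₀hi + ((B.R' : ℕ) : Site 2))) :
    Finset.Icc (c - ((B.pr : ℕ) : Site 2)) (c + ((B.pr : ℕ) : Site 2)) ⊆ Finset.Icc B.regionLo B.regionHi := by
  rw [Finset.mem_Icc, Pi.le_def, Pi.le_def] at hc
  refine Finset.Icc_subset_Icc (fun i => ?_) (fun i => ?_) <;> have h1 := hc.1 i <;> have h2 := hc.2 i <;>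
    simp only [Pi.sub_apply, Pi.add_apply, Pi.natCast_apply, regionLo_apply, regionHi_apply] at h1 h2 ⊢ <;> omega

/-- **Route fact 2**: the landing box `c + [dlo, dhi]` of a kit centre `c` of the enlarged core `0` lies in core `1`. [this work] -/
theorem disp_subset_core1_of_mem_enl {c : Site 2} (hc : c ∈ Finset.Icc (B.B₀lo - ((B.R' : ℕ) : Site 2)) (B.B₀hi + ((B.R' : ℕ) : Site 2))) :
    Finset.Icc (c + B.dlo) (c + B.dhi) ⊆ Finset.Icc B.core1Lo B.core1Hi := by
  rw [Finset.mem_Icc, Pi.le_def, Pi.le_def] at hc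
  refine Finset.Icc_subset_Icc (fun i => ?_) (fun i => ?_) <;> have h1 := hc.1 i <;> have h2 := hc.2 i <;>
    simp only [Pi.sub_apply, Pi.add_apply, Pi.natCast_apply, core1Lo_apply, core1Hi_apply] at h1 h2 ⊢ <;> omega

/-- **Clearance reading 1**: every point of the region has coordinate `i` at least `B₀lo i − R′ − pr`. [folklore] -/
theorem le_of_mem_region {y : Site 2} (hy : y ∈ Finset.Icc B.regionLo B.regionHi) (i : Fin 2) : B.B₀lo i - B.R' - B.pr ≤ y i := by
  have := (Finset.mem_Icc.1 hy).1 i; rwa [regionLo_apply] at this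

/-- **Clearance reading 2**: every point of core `1` has coordinate `i` at least `B₀lo i − R′ + dlo i`. [folklore] -/
theorem le_of_mem_core1 {y : Site 2} (hy : y ∈ Finset.Icc B.core1Lo B.core1Hi) (i : Fin 2) : B.B₀lo i - B.R' + B.dlo i ≤ y i := by
  have := (Finset.mem_Icc.1 hy).1 i; rwa [core1Lo_apply] at this

/-- Every point of core `1` has coordinate `i` at most `B₀hi i + R′ + dhi i`. [folklore] -/
theorem le_of_mem_core1' {y : Site 2} (hy : y ∈ Finset.Icc B.core1Lo B.core1Hi) (i : Fin 2) : y i ≤ B.B₀hi i + B.R' + B.dhi i := by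
  have := (Finset.mem_Icc.1 hy).2 i; rwa [core1Hi_apply] at this

end BridgePrm

end ChainPlanar

end Transplant

end Summit.CriticalPhenomena.PercolationContinuityZ3.Theorems

end
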